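import Literature.Combinatorics.Sahi2008.ProductOfChains
import Literature.Combinatorics.Sahi2008.Percolation
import Literature.Combinatorics.Sahi2008.CumulationCone
import HarnessLib

/-!
# `NoHeavyLowerTail` (stmt-CriticalPhenomena-4575) — Kahn's / Sahi's `C_n` for TWO-BLOCK EXCHANGEABLE families on the
# Boolean cube, every order `n`, every product (coin) measure

Support file (new-inequality factory seat prim-ineq-gen-4, gen 8; `--supports stmt-CriticalPhenomena-4575`).  No named
facts, no sorries; nothing here is specific to percolation.

Context (memo run/shared/lean/prim/prim-ineq-gen-4/FINDING-CLT-WIDTH-LARGE-M-g8.md §1, "width stratification").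
Kahn's Conjecture 5 [Kahn2022] = Sahi's `C₃` for product measures on `{0,1}^m` is open; the tree holds Sahi positivity of
EVERY order for every product weight on a product of TWO finite chains
(`Literature.Combinatorics.Sahi2008.ProductChains.sahiPositive_prodWeight_linearOrder`, the discrete Lieb–Sahi Thm. 3.7,
and even for every FKG weight there, `SahiTwoDim.sahiPositive_of_isFKGMeasure_prod`).  Split the coordinates of the
cube `Fin (m + r) → Bool` into the first `m` and the last `r`; a function of a configuration that depends on it only
through the two BLOCK COUNTS (number of `true` coordinates in each block) is "two-block exchangeable".  The push-forward of
ANY coin (product) weight along the block-count map is a product weight on the chain product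
`Fin (m+1) × Fin (r+1)` (`pushWeight_coinWeight_blockCount`, the two counts are independent), so Sahi positivity of every
order pulls back (`sahiE_pushWeight`):

* `sahiE_coinWeight_blockExchangeable_nonneg` — for every `q : Fin (m+r) → [0,1]`, every `n`, and all nonnegative
  `g₀,…,g_{n−1} : Fin (m+1) × Fin (r+1) → ℝ` monotone in the two counts,
  `E_n^{coin q}(g₀ ∘ blockCount, …, g_{n−1} ∘ blockCount) ≥ 0`.
  In particular Kahn's `C₃` (and `C_n`) holds on `{0,1}^{m+r}` for every triple (tuple) of increasing events each of the form
  "`(S₁, S₂) ∈ 𝒰`" with `S₁, S₂` the block counts and `𝒰` an up-set of `Fin (m+1) × Fin (r+1)` — e.g. all weighted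
  thresholds `a S₁ + b S₂ ≥ θ` (`a, b ≥ 0`) and unions of such — for EVERY coin vector `q` (not only block-constant ones)
  and every `m, r`.  The three-block analogue is exactly the first open case (tree:
  `SahiThreeDim.liebSahi_prod₃_iff_fkg_prod₃`).
* `sahiE3_prodBernoulli_blockExchangeable_nonneg` — the EVENT form, literally an instance of the body of
  `KahnConjecture`: for `p : Fin (m+r) → [0,1]` and up-sets `𝒰_A, 𝒰_B, 𝒰_C` of `Fin (m+1) × Fin (r+1)`,
  `0 ≤ sahiE3 (prodBernoulli p) {S | setBlockCount S ∈ 𝒰_A} {S | setBlockCount S ∈ 𝒰_B} {S | setBlockCount S ∈ 𝒰_C}`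
  (transfer along `(Fin k → Bool) ≃ Set (Fin k)` and `sahiE_three_ind`).
-/

namespace Summit.CriticalPhenomena.PercolationContinuityZ3.Theorems

namespace SahiBlockExchangeable

open Finset Function Literature.Combinatorics.Sahi2008
open scoped BigOperators

noncomputable section

variable {m r : ℕ}

/-- Number of `true` coordinates of a Boolean configuration on `Fin k`, as an element of `Fin (k+1)`. [this work] -/
def count {k : ℕ} (y : Fin k → Bool) : Fin (k + 1) :=
  ⟨(univ.filter fun i => y i = true).card,
    Nat.lt_succ_of_le ((card_filter_le _ _).trans (by rw [card_univ, Fintype.card_fin]))⟩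

/-- The **two block counts** of a configuration on `Fin (m + r)`: (number of `true`s among the first `m`
coordinates, number of `true`s among the last `r`). [this work] -/
def blockCount (m r : ℕ) (y : Fin (m + r) → Bool) : Fin (m + 1) × Fin (r + 1) :=
  (count fun i : Fin m => y (Fin.castAdd r i), count fun j : Fin r => y (Fin.natAdd m j))

/-- On an appended configuration the block counts are the counts of the two pieces. [this work] -/
theorem blockCount_append (y₁ : Fin m → Bool) (y₂ : Fin r → Bool) :
    blockCount m r (Fin.append y₁ y₂) = (count y₁, count y₂) := by
  unfold blockCount
  simp only [Fin.append_left, Fin.append_right]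

/-- **The block counts of independent coins are independent**: the push-forward of the coin weight `q` along
`blockCount` is the product of the push-forwards of the two block coin weights along their counts. [this work] -/
theorem pushWeight_coinWeight_blockCount (q : Fin (m + r) → ℝ) :
    pushWeight (coinWeight q) (blockCount m r) = fun p =>
      pushWeight (coinWeight fun i : Fin m => q (Fin.castAdd r i)) count p.1 *
        pushWeight (coinWeight fun j : Fin r => q (Fin.natAdd m j)) count p.2 := by
  classical
  funext p
  rw [pushWeight_apply, pushWeight_apply, pushWeight_apply]
  -- reindex the cube `Fin (m + r) → Bool` by pairs of block configurations
  rw [← Fintype.sum_equiv (Fin.appendEquiv m r)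
    (fun yy => if blockCount m r (Fin.append yy.1 yy.2) = p then coinWeight q (Fin.append yy.1 yy.2) else 0) _
    (fun yy => rfl)]
  have hq : q = Fin.append (fun i : Fin m => q (Fin.castAdd r i)) (fun j : Fin r => q (Fin.natAdd m j)) :=
    (Fin.append_castAdd_natAdd (f := q)).symm
  simp only [blockCount_append]
  rw [Fintype.sum_prod_type, sum_mul_sum]
  refine sum_congr rfl fun y₁ _ => sum_congr rfl fun y₂ _ => ?_
  rw [hq, coinWeight_append, ← hq]
  by_cases h1 : count y₁ = p.1 <;> by_cases h2 : count y₂ = p.2 <;> simp [h1, h2, Prod.ext_iff]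

/-- The push-forward of a coin weight with `q ∈ [0,1]` along any map is a probability weight (plumbing). [this work] -/
theorem pushWeight_coinWeight_nonneg {k : ℕ} {γ : Type*} {q : Fin k → ℝ} (hq : ∀ i, 0 ≤ q i ∧ q i ≤ 1)
    (G : (Fin k → Bool) → γ) (c : γ) : 0 ≤ pushWeight (coinWeight q) G c :=
  pushWeight_nonneg (coinWeight_nonneg hq) G c

/-- Total mass of the push-forward of a coin weight (plumbing). [this work] -/
theorem sum_pushWeight_coinWeight {k : ℕ} {γ : Type*} [Fintype γ] (q : Fin k → ℝ)
    (G : (Fin k → Bool) → γ) : ∑ c, pushWeight (coinWeight q) G c = 1 := by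
  classical
  rw [sum_pushWeight, sum_coinWeight]

/-- **The law of the two block counts is Sahi-positive of every order** (a product weight on a product of two finite
chains, `ProductChains.sahiPositive_prodWeight_linearOrder`). [this work] -/
theorem sahiPositive_pushWeight_blockCount {q : Fin (m + r) → ℝ} (hq : ∀ i, 0 ≤ q i ∧ q i ≤ 1) (n : ℕ) :
    SahiPositive (pushWeight (coinWeight q) (blockCount m r)) n := by
  rw [pushWeight_coinWeight_blockCount]
  set w₁ : Fin (m + 1) → ℝ := pushWeight (coinWeight fun i : Fin m => q (Fin.castAdd r i)) count with hw₁
  set w₂ : Fin (r + 1) → ℝ := pushWeight (coinWeight fun j : Fin r => q (Fin.natAdd m j)) count with hw₂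
  have h10 : ∀ x, 0 ≤ w₁ x := fun x => pushWeight_coinWeight_nonneg (fun i => hq _) _ x
  have h11 : ∑ x, w₁ x = 1 := sum_pushWeight_coinWeight _ _
  have h20 : ∀ y, 0 ≤ w₂ y := fun y => pushWeight_coinWeight_nonneg (fun j => hq _) _ y
  have h21 : ∑ y, w₂ y = 1 := sum_pushWeight_coinWeight _ _
  exact ProductChains.sahiPositive_prodWeight_linearOrder w₁ w₂ h10 h11 h20 h21 n

/-- **Sahi's `C_n` for two-block exchangeable families under every coin measure.**  For `q ∈ [0,1]^{m+r}`, every order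
`n` and all nonnegative `g_i : Fin (m+1) × Fin (r+1) → ℝ` that are monotone in the pair of block counts,
`E_n^{coin q}(g₀ ∘ blockCount, …, g_{n−1} ∘ blockCount) ≥ 0`.  (Kahn's Conjecture 5 for this class at `n = 3`.) [this work] -/
theorem sahiE_coinWeight_blockExchangeable_nonneg {q : Fin (m + r) → ℝ} (hq : ∀ i, 0 ≤ q i ∧ q i ≤ 1) (n : ℕ)
    (g : Fin n → Fin (m + 1) × Fin (r + 1) → ℝ) (hg0 : ∀ i c, 0 ≤ g i c) (hmono : ∀ i, Monotone (g i)) :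
    0 ≤ sahiE (coinWeight q) n fun i => g i ∘ blockCount m r := by
  rw [← sahiE_pushWeight]
  exact sahiPositive_pushWeight_blockCount hq n g hg0 hmono

/-- The case `n = 3` spelled out (Kahn's `C₃` / Richards' `E₃ ≥ 0` for three two-block exchangeable nonnegative monotone
functions of independent coins). [this work] -/
theorem sahiE_three_coinWeight_blockExchangeable_nonneg {q : Fin (m + r) → ℝ} (hq : ∀ i, 0 ≤ q i ∧ q i ≤ 1)
    (g₀ g₁ g₂ : Fin (m + 1) × Fin (r + 1) → ℝ) (h0 : ∀ c, 0 ≤ g₀ c) (h1 : ∀ c, 0 ≤ g₁ c) (h2 : ∀ c, 0 ≤ g₂ c)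
    (hm0 : Monotone g₀) (hm1 : Monotone g₁) (hm2 : Monotone g₂) :
    0 ≤ sahiE (coinWeight q) 3 ![g₀ ∘ blockCount m r, g₁ ∘ blockCount m r, g₂ ∘ blockCount m r] := by
  have hfun : (![g₀ ∘ blockCount m r, g₁ ∘ blockCount m r, g₂ ∘ blockCount m r] :
      Fin 3 → (Fin (m + r) → Bool) → ℝ) = fun i => ![g₀, g₁, g₂] i ∘ blockCount m r := by
    funext i
    fin_cases i <;> rfl
  rw [hfun]
  exact sahiE_coinWeight_blockExchangeable_nonneg hq 3 ![g₀, g₁, g₂]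
    (fun i c => by fin_cases i <;> simp [h0, h1, h2]) (fun i => by fin_cases i <;> simpa)

/-! ## Event form: Kahn's `C₃` statement for two-block exchangeable increasing events -/

section Events

open Literature.Probability.LatticeModels (prodBernoulli sahiE3)
open Literature.Probability.Percolation.DecisionTree (ind ind_of_mem ind_of_not_mem ind_nonneg)

/-- Boolean configurations on `Fin k` as subsets of `Fin k` (plumbing). [this work] -/
def cubeEquivSet (k : ℕ) : (Fin k → Bool) ≃ Set (Fin k) where
  toFun y := {i | y i = true}
  invFun S i := by classical exact decide (i ∈ S)
  left_inv y := by funext i; simp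
  right_inv S := by ext i; simp

/-- Membership in `cubeEquivSet k y` is `y i = true` (plumbing). [this work] -/
theorem mem_cubeEquivSet {k : ℕ} (y : Fin k → Bool) (i : Fin k) : i ∈ cubeEquivSet k y ↔ y i = true :=
  Iff.rfl

/-- The two block counts of a subset of `Fin (m + r)`. [this work] -/
def setBlockCount (m r : ℕ) (S : Set (Fin (m + r))) : Fin (m + 1) × Fin (r + 1) :=
  blockCount m r ((cubeEquivSet (m + r)).symm S)

/-- `setBlockCount` read through the equivalence (plumbing). [this work] -/
theorem setBlockCount_cubeEquivSet (y : Fin (m + r) → Bool) :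
    setBlockCount m r (cubeEquivSet (m + r) y) = blockCount m r y := by
  unfold setBlockCount
  rw [Equiv.symm_apply_apply]

/-- The tree's product weight `bernoulliWeight p` on `Set (Fin k)`, read on Boolean configurations, is the coin weight
with the same parameters (plumbing). [this work] -/
theorem bernoulliWeight_comp_cubeEquivSet {k : ℕ} (p : Fin k → unitInterval) :
    (bernoulliWeight p ∘ cubeEquivSet k) = coinWeight fun i => (p i : ℝ) := by
  funext y
  simp only [Function.comp_apply]
  unfold bernoulliWeight Literature.Probability.Percolation.BHK2006.weight coinWeight
  refine Fintype.prod_congr _ _ fun i => ?_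
  simp only [mem_cubeEquivSet]

/-- The indicator of an up-set of any preorder is monotone (plumbing; cf. `monotone_ind_of_isUpperSet` for `Set ι`). [folklore] -/
theorem monotone_ind_of_isUpperSet' {γ : Type*} [Preorder γ] {U : Set γ} (hU : IsUpperSet U) : Monotone (ind U) := by
  intro a b hab
  by_cases ha : a ∈ U
  · rw [ind_of_mem ha, ind_of_mem (hU hab ha)]
  · rw [ind_of_not_mem ha]
    exact ind_nonneg U b

/-- The indicator of `{S | setBlockCount S ∈ 𝒰}`, read on Boolean configurations, is `ind 𝒰 ∘ blockCount` (plumbing). [this work] -/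
theorem ind_setOf_setBlockCount_comp (𝒰 : Set (Fin (m + 1) × Fin (r + 1))) :
    ind {S : Set (Fin (m + r)) | setBlockCount m r S ∈ 𝒰} ∘ cubeEquivSet (m + r) = ind 𝒰 ∘ blockCount m r := by
  funext y
  simp only [Function.comp_apply]
  by_cases h : blockCount m r y ∈ 𝒰
  · rw [ind_of_mem h, ind_of_mem (show cubeEquivSet (m + r) y ∈ _ by
      rw [Set.mem_setOf_eq, setBlockCount_cubeEquivSet]; exact h)]
  · rw [ind_of_not_mem h, ind_of_not_mem (show cubeEquivSet (m + r) y ∉ _ by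
      rw [Set.mem_setOf_eq, setBlockCount_cubeEquivSet]; exact h)]

/-- **Kahn's `C₃` for two-block exchangeable increasing events** (event form of
`sahiE_three_coinWeight_blockExchangeable_nonneg`): for every `p : Fin (m+r) → [0,1]` and all up-sets
`𝒰_A, 𝒰_B, 𝒰_C` of the count lattice `Fin (m+1) × Fin (r+1)`, the three increasing events "the pair of block counts lies in
`𝒰_·`" satisfy `0 ≤ E₃` under `prodBernoulli p`. [this work] -/
theorem sahiE3_prodBernoulli_blockExchangeable_nonneg (p : Fin (m + r) → unitInterval)
    {UA UB UC : Set (Fin (m + 1) × Fin (r + 1))} (hA : IsUpperSet UA) (hB : IsUpperSet UB) (hC : IsUpperSet UC) :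
    0 ≤ sahiE3 (prodBernoulli p) {S | setBlockCount m r S ∈ UA} {S | setBlockCount m r S ∈ UB}
      {S | setBlockCount m r S ∈ UC} := by
  rw [← sahiE_three_ind, ← sahiE_comp_equiv (cubeEquivSet (m + r)) (bernoulliWeight p) 3,
    bernoulliWeight_comp_cubeEquivSet]
  have hfun : (fun i => (![ind {S : Set (Fin (m + r)) | setBlockCount m r S ∈ UA},
      ind {S : Set (Fin (m + r)) | setBlockCount m r S ∈ UB},
      ind {S : Set (Fin (m + r)) | setBlockCount m r S ∈ UC}] : Fin 3 → Set (Fin (m + r)) → ℝ) i ∘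
        cubeEquivSet (m + r)) =
      ![ind UA ∘ blockCount m r, ind UB ∘ blockCount m r, ind UC ∘ blockCount m r] := by
    funext i
    fin_cases i
    · exact ind_setOf_setBlockCount_comp UA
    · exact ind_setOf_setBlockCount_comp UB
    · exact ind_setOf_setBlockCount_comp UC
  rw [hfun]
  exact sahiE_three_coinWeight_blockExchangeable_nonneg (fun i => ⟨(p i).2.1, (p i).2.2⟩) (ind UA) (ind UB)
    (ind UC) (ind_nonneg UA) (ind_nonneg UB) (ind_nonneg UC) (monotone_ind_of_isUpperSet' hA)
    (monotone_ind_of_isUpperSet' hB) (monotone_ind_of_isUpperSet' hC)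

end Events

end

end SahiBlockExchangeable

end Summit.CriticalPhenomena.PercolationContinuityZ3.Theorems
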